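import Literature.Geometry.Symplectic.OrigamiSphere
import Literature.NumberTheory.Transcendental.FormIntegrationCharts
import Mathlib.Analysis.SpecialFunctions.Trigonometric.Deriv
import HarnessLib

/-!
# The origami 4-sphere: proof of Cannas da Silva–Guillemin–Pires 2010, Example 2.3

Topic `Literature/Geometry/Symplectic`; sibling proofs file of `OrigamiSphere.lean`, which states the
NAMED FACT `CannasDaSilvaGuilleminPires2010_example_2_3`: the restriction `sphereOrigamiForm` of
`ω₀ = dx₁ ∧ dy₁ + dx₂ ∧ dy₂` to the unit sphere `S⁴ ⊂ ℂ² × ℝ` is an origami form (the tree's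
`IsOrigamiForm`, Def. 2.1/2.2 of the paper for `n = 2`) and its fold is the equator `{h = 0}`.
This file DISCHARGES it: `CannasDaSilvaGuilleminPires2010_example_2_3_holds`.

A. Cannas da Silva, V. Guillemin, A. R. Pires, *Symplectic Origami*, IMRN 2011 = arXiv:0909.4065,
§2.1, Example 2.3 (read): "Let `ω₀` be the restriction to `S²ⁿ` of `dx₁ ∧ dy₁ + … + dxₙ ∧ dyₙ`.
Then `ω₀` is a folded symplectic form. The folding hypersurface is the equator sphere given by
the intersection with the plane `h = 0`. The null foliation is the Hopf foliation since
`ι_{∂/∂θ₁ + … + ∂/∂θₙ} ω₀ = -r₁ dr₁ - … - rₙ drₙ` is trivial on `Z`, hence the null fibration is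
`S¹ ↪ S²ⁿ⁻¹ ↠ ℂℙⁿ⁻¹`." The printed example gives no further computation; the verification below
is the standard one, organised as follows (`ι : S⁴ ↪ ℝ⁵`, `dι = mfderiv _ _ Subtype.val`, which is
injective with range `(ℝ ∙ x)ᗮ` — Mathlib's `mfderiv_coe_sphere_injective`, `range_mfderiv_coe_sphere`).

* `fold_sphereOrigamiForm` — the fold (degeneracy locus of `ω₀|_{T S⁴}`) is `{h = 0}`: writing
  `ω₀(V, W) = ⟪A V, W⟫` with `A V = (-V₁, V₀, -V₃, V₂, 0)`, a kernel vector `V ∈ x^⊥` forces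
  `A V ∈ ℝ x`, whose last coordinate vanishes; on the equator `(x₁, -x₀, x₃, -x₂, 0)` spans the
  kernel.
* `isSmoothForm_sphereOrigamiForm`, `isClosedForm_sphereOrigamiForm` — the chart representative in
  the stereographic chart at `x` is the pull-back `ω₀ ∘ Dg` of the CONSTANT form `ω₀` along the
  `C^∞` parametrisation `g = ι ∘ σ⁻¹ : ℝ⁴ → ℝ⁵` (`sphereOrigamiForm_inChart`); smoothness from the
  tree's `ContDiffAt.continuousAlternatingMapCompContinuousLinearMap`, closedness from Mathlib's
  `extDeriv_pullback` and `dω₀ = 0`.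
* `equatorIncl`, `isSmoothEmbedding_equatorIncl` — the equator `j : S³ ↪ S⁴`, `n ↦ (n, 0)`, is a
  `C^∞` embedding (Mathlib's chart definition of immersions): since `pad ∘ stereoInv_{-n} =
  stereoInv_{-j n} ∘ pad`, in the stereographic charts at `n` and `j n` the map `j` is the linear
  injection `U₄ ∘ pad ∘ U₃⁻¹`, completed to `ℝ³ × ℝ ≃ ℝ⁴` by the normal direction `e₄`.
* `sphereOrigamiForm_transverse` — `ω ∧ ω ⋔ 0` along the fold: the chart Pfaffian is
  `Pf(ω₀ ∘ Dg) = vol₅(e₄, ∂₀g, …, ∂₃g) = (h ∘ g) · vol₅(g, ∂₀g, …, ∂₃g)` (the `∂ⱼg` are orthogonal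
  to the unit vector `g`; five vectors of `g^⊥` have zero volume), i.e. `ω ∧ ω = 2h dvol_{S⁴}`; at
  the centre of a chart at an equator point the second factor is `vol₅(x, dι e₀, …, dι e₃) ≠ 0` and
  `D(h ∘ g) ≠ 0` because `∂/∂h ∈ T_x S⁴`.
* `sphereOrigamiForm_maximalRank` — on the equator `∂/∂h` lies in `ker ω₀` and is not tangent to
  the equator.
* `hopfAction`, `contMDiff_hopfAction`, `hopfAction_eq_self`, `sphereOrigamiForm_orbit_tangent` —
  the free Hopf circle action `a · (z₁, z₂) = (a z₁, a z₂)` on `S³`, whose orbit velocity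
  `pad (J n)` satisfies `ω₀(pad (J n), W) = -⟪j n, W⟫ = 0` on `T_{jn} S⁴` (the printed
  "`ι_{∂/∂θ₁+∂/∂θ₂} ω₀` is trivial on `Z`").
* `isFoldedForm_sphereOrigamiForm`, `isOrigamiForm_sphereOrigamiForm`,
  `CannasDaSilvaGuilleminPires2010_example_2_3_holds` — assembly.

## Design notes

* Everything is specific to `S⁴ ⊂ ℝ⁵` and `n = 2`, as the fact is stated; no new named facts.
* The general-`n` statement, Example 2.4 (`ℝℙ²ⁿ`) and Example 2.6 (cutting into `ℂℙⁿ`, `ℂℙⁿ`-bar)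
  are deliberately NOT here.
* `Fact (finrank ℝ ℝ⁵ = 4 + 1)` (and the `Fin (4 + 1)` spelling produced by the sphere notation) are
  local instances feeding Mathlib's sphere API.

## References

* [CannasdasilvaGuilleminPires2010] A. Cannas da Silva, V. Guillemin, A. R. Pires, *Symplectic
  Origami*, Int. Math. Res. Not. IMRN 2011 (18), 4252–4293, doi:10.1093/imrn/rnq241 =
  arXiv:0909.4065, Def. 2.1, Def. 2.2, Example 2.3.
-/

noncomputable section

open scoped Manifold ContDiff Topology
open Set Function
open Literature.Geometry.Kaehler

namespace Literature.Geometry.Symplectic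

/-- Local notation: `𝔼 n` is the model space `EuclideanSpace ℝ (Fin n)`. -/
local notation "𝔼" n:arg => EuclideanSpace ℝ (Fin n)

/-- Local notation: `𝕊 n` is the unit sphere in `EuclideanSpace ℝ (Fin (n + 1))`. -/
local notation "𝕊 " n:arg => (Metric.sphere (0 : EuclideanSpace ℝ (Fin (n + 1))) 1)

/-! ## Proof of Example 2.3 (`n = 2`)

The printed example asserts the origami property without computation; the verification below is
the standard one. Throughout, `ι : S⁴ ↪ ℝ⁵` is the inclusion, `dι = mfderiv _ _ Subtype.val`
(injective with range `(ℝ ∙ x)ᗮ`, Mathlib `mfderiv_coe_sphere_injective`,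
`range_mfderiv_coe_sphere`), and `ω₀(V, W) = ⟪A V, W⟫` with `A V = (-V₁, V₀, -V₃, V₂, 0)`. -/

section Example23Proofs

open scoped InnerProductSpace

/-- The `Fact` instance feeding Mathlib's sphere API (`range_mfderiv_coe_sphere`, …) for
`S⁴ ⊂ ℝ⁵`. [folklore] -/
private theorem fact_finrank_five : Fact (Module.finrank ℝ (𝔼 5) = 4 + 1) :=
  ⟨finrank_euclideanSpace_fin⟩

/-- The `Fact` instance feeding Mathlib's sphere API for `S³ ⊂ ℝ⁴`. [folklore] -/
private theorem fact_finrank_four : Fact (Module.finrank ℝ (𝔼 4) = 3 + 1) :=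
  ⟨finrank_euclideanSpace_fin⟩

/-- The `Fact` instance for `S⁴ ⊂ ℝ⁵` with the ambient space spelled `ℝ^(4+1)` (the spelling
produced by the notation `𝕊 4`). [folklore] -/
private theorem fact_finrank_five' :
    Fact (Module.finrank ℝ (EuclideanSpace ℝ (Fin (4 + 1))) = 4 + 1) :=
  ⟨finrank_euclideanSpace_fin⟩

/-- The `Fact` instance for `S³ ⊂ ℝ⁴` with the ambient space spelled `ℝ^(3+1)`. [folklore] -/
private theorem fact_finrank_four' :
    Fact (Module.finrank ℝ (EuclideanSpace ℝ (Fin (3 + 1))) = 3 + 1) :=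
  ⟨finrank_euclideanSpace_fin⟩

attribute [local instance] fact_finrank_five fact_finrank_four fact_finrank_five'
  fact_finrank_four'

/-! ### Linear algebra of `ω₀` on `ℝ⁵` -/

/-- The endomorphism `A` of `ℝ⁵` representing `ω₀` through the inner product,
`A V = (-V₁, V₀, -V₃, V₂, 0)`. [folklore] -/
def rotFive (V : 𝔼 5) : 𝔼 5 := WithLp.toLp 2 ![-(V 1), V 0, -(V 3), V 2, 0]

/-- `(A V)₀ = -V₁`. [folklore] -/
@[simp] private theorem rotFive_apply_zero (V : 𝔼 5) : rotFive V 0 = -(V 1) := rfl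
/-- `(A V)₁ = V₀`. [folklore] -/
@[simp] private theorem rotFive_apply_one (V : 𝔼 5) : rotFive V 1 = V 0 := rfl
/-- `(A V)₂ = -V₃`. [folklore] -/
@[simp] private theorem rotFive_apply_two (V : 𝔼 5) : rotFive V 2 = -(V 3) := rfl
/-- `(A V)₃ = V₂`. [folklore] -/
@[simp] private theorem rotFive_apply_three (V : 𝔼 5) : rotFive V 3 = V 2 := rfl
/-- `(A V)₄ = 0`. [folklore] -/
@[simp] private theorem rotFive_apply_four (V : 𝔼 5) : rotFive V 4 = 0 := rfl

/-- The real inner product on `ℝ⁵` in coordinates. [folklore] -/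
private theorem euclid_inner_five (V W : 𝔼 5) :
    ⟪V, W⟫_ℝ = V 0 * W 0 + V 1 * W 1 + V 2 * W 2 + V 3 * W 3 + V 4 * W 4 := by
  simp [PiLp.inner_apply, Fin.sum_univ_five, mul_comm]

/-- `ω₀(V, W) = ⟪A V, W⟫`. [folklore] -/
theorem presymplecticAltFive_eq_inner_rotFive (V W : 𝔼 5) :
    presymplecticAltFive ![V, W] = ⟪rotFive V, W⟫_ℝ := by
  rw [presymplecticAltFive_apply, euclid_inner_five]
  simp
  ring

/-- The vector `V' = (x₁, -x₀, x₃, -x₂, 0)` built from a point `x` satisfies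
`ω₀(V', W) = ⟪x, W⟫ - x₄ W₄`. [folklore] -/
private theorem presymplecticAltFive_swapVec (x W : 𝔼 5) :
    presymplecticAltFive ![WithLp.toLp 2 ![x 1, -(x 0), x 3, -(x 2), 0], W] =
      ⟪x, W⟫_ℝ - x 4 * W 4 := by
  rw [presymplecticAltFive_apply, euclid_inner_five]
  simp
  ring

/-! ### The fold is the equator -/

/-- `dι v ⟂ x` (Mathlib's `range_mfderiv_coe_sphere`, on the tree's instance path).
[folklore] -/
private theorem mfderiv_val_mem_orthogonal (x : 𝕊 4) (v : TangentSpace (𝓡 4) x) :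
    (mfderiv (𝓡 4) 𝓘(ℝ, 𝔼 5) (Subtype.val : (𝕊 4) → 𝔼 5) x v : 𝔼 5) ∈ (ℝ ∙ (x : 𝔼 5))ᗮ := by
  rw [← range_mfderiv_coe_sphere (E := 𝔼 5) (n := 4) x]
  exact ⟨v, rfl⟩

/-- `⟪x, dι v⟫ = 0`. [folklore] -/
private theorem inner_mfderiv_val_sphere (x : 𝕊 4) (v : TangentSpace (𝓡 4) x) :
    ⟪(x : 𝔼 5), (mfderiv (𝓡 4) 𝓘(ℝ, 𝔼 5) (Subtype.val : (𝕊 4) → 𝔼 5) x v : 𝔼 5)⟫_ℝ = 0 :=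
  (Submodule.mem_orthogonal_singleton_iff_inner_right).1 (mfderiv_val_mem_orthogonal x v)

/-- Every vector orthogonal to `x` is `dι v` for some tangent vector `v`. [folklore] -/
private theorem exists_mfderiv_val_sphere_eq (x : 𝕊 4) {V : 𝔼 5} (hV : ⟪(x : 𝔼 5), V⟫_ℝ = 0) :
    ∃ v : TangentSpace (𝓡 4) x,
      (mfderiv (𝓡 4) 𝓘(ℝ, 𝔼 5) (Subtype.val : (𝕊 4) → 𝔼 5) x v : 𝔼 5) = V := by
  have h : V ∈ (ℝ ∙ (x : 𝔼 5))ᗮ := (Submodule.mem_orthogonal_singleton_iff_inner_right).2 hV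
  rw [← range_mfderiv_coe_sphere (E := 𝔼 5) (n := 4) x] at h
  obtain ⟨v, hv⟩ := h
  exact ⟨v, hv⟩

/-- **The fold of `ω₀|_{S⁴}` is the equator `{h = 0}`** (Cannas da Silva–Guillemin–Pires 2010,
Example 2.3: "The folding hypersurface is the equator sphere given by the intersection with the
plane `h = 0`"). At `x` with `x₄ ≠ 0` the form is non-degenerate on `T_x S⁴ = x^⊥`
(`ω₀(V, ·)|_{x^⊥} = 0` forces `A V ∈ ℝ x`, whose last coordinate gives `A V = 0`); at `x₄ = 0`
the tangent vector `(x₁, -x₀, x₃, -x₂, 0)` spans the kernel.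
[cite: CannasdasilvaGuilleminPires2010, Example 2.3] -/
theorem fold_sphereOrigamiForm : fold sphereOrigamiForm = {x : 𝕊 4 | (x : 𝔼 5) 4 = 0} := by
  ext x
  rw [mem_fold_iff, mem_setOf_eq]
  set D := mfderiv (𝓡 4) 𝓘(ℝ, 𝔼 5) (Subtype.val : (𝕊 4) → 𝔼 5) x with hD
  have hinj : Injective D := mfderiv_coe_sphere_injective (E := 𝔼 5) (n := 4) x
  have hxx : ⟪(x : 𝔼 5), (x : 𝔼 5)⟫_ℝ = 1 := by
    rw [real_inner_self_eq_norm_sq, norm_eq_of_mem_sphere x, one_pow]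
  constructor
  · rintro ⟨v, hv, h⟩
    by_contra hx4
    set V : 𝔼 5 := D v with hV
    -- `A V` is orthogonal to `x^⊥`, hence a multiple of `x`
    have hAV : rotFive V ∈ (ℝ ∙ (x : 𝔼 5))ᗮᗮ := by
      rw [Submodule.mem_orthogonal]
      intro W hW
      obtain ⟨w, rfl⟩ := exists_mfderiv_val_sphere_eq x
        ((Submodule.mem_orthogonal_singleton_iff_inner_right).1 hW)
      rw [real_inner_comm, ← presymplecticAltFive_eq_inner_rotFive]
      have := h w
      rwa [sphereOrigamiForm_apply] at this
    rw [Submodule.orthogonal_orthogonal, Submodule.mem_span_singleton] at hAV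
    obtain ⟨c, hc⟩ := hAV
    have h4 : c * (x : 𝔼 5) 4 = 0 := by
      have := congrArg (fun z : 𝔼 5 => z 4) hc
      simpa using this
    have hc0 : c = 0 := by
      rcases mul_eq_zero.1 h4 with h | h
      · exact h
      · exact absurd h hx4
    rw [hc0, zero_smul] at hc
    have h0 : V 0 = 0 := by
      have := congrArg (fun z : 𝔼 5 => z 1) hc; simp at this; linarith
    have h1 : V 1 = 0 := by
      have := congrArg (fun z : 𝔼 5 => z 0) hc; simp at this; linarith
    have h2 : V 2 = 0 := by
      have := congrArg (fun z : 𝔼 5 => z 3) hc; simp at this; linarith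
    have h3 : V 3 = 0 := by
      have := congrArg (fun z : 𝔼 5 => z 2) hc; simp at this; linarith
    -- `V ⟂ x` then forces `V₄ = 0`
    have hVx : ⟪(x : 𝔼 5), V⟫_ℝ = 0 := inner_mfderiv_val_sphere x v
    rw [euclid_inner_five, h0, h1, h2, h3] at hVx
    have hV4 : V 4 = 0 := by
      have : (x : 𝔼 5) 4 * V 4 = 0 := by linarith
      rcases mul_eq_zero.1 this with h | h
      · exact absurd h hx4
      · exact h
    apply hv
    apply hinj
    rw [map_zero]
    change V = (0 : 𝔼 5)
    ext i
    fin_cases i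
    · simpa using h0
    · simpa using h1
    · simpa using h2
    · simpa using h3
    · simpa using hV4
  · intro hx4
    set V' : 𝔼 5 :=
      WithLp.toLp 2 ![(x : 𝔼 5) 1, -((x : 𝔼 5) 0), (x : 𝔼 5) 3, -((x : 𝔼 5) 2), 0] with hV'
    obtain ⟨v, hv⟩ := exists_mfderiv_val_sphere_eq x (V := V') (by
        rw [hV', euclid_inner_five]; simp; ring)
    refine ⟨v, ?_, fun w => ?_⟩
    · intro h0
      have h1 : V' = 0 := by
        rw [← hv, h0, map_zero]
        rfl
      have e0 := congrArg (fun z : 𝔼 5 => z 0) h1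
      have e1 := congrArg (fun z : 𝔼 5 => z 1) h1
      have e2 := congrArg (fun z : 𝔼 5 => z 2) h1
      have e3 := congrArg (fun z : 𝔼 5 => z 3) h1
      simp [hV'] at e0 e1 e2 e3
      have hn : ⟪(x : 𝔼 5), (x : 𝔼 5)⟫_ℝ = 0 := by
        rw [euclid_inner_five, e0, e1, e2, e3, hx4]
        ring
      rw [hxx] at hn
      exact one_ne_zero hn
    · rw [sphereOrigamiForm_apply, ← hD]
      rw [hv, hV', presymplecticAltFive_swapVec, hx4, zero_mul, sub_zero]
      exact inner_mfderiv_val_sphere x w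

end Example23Proofs

section Example23Equator

open scoped InnerProductSpace

attribute [local instance] fact_finrank_five fact_finrank_four fact_finrank_five' fact_finrank_four'
  finrank_real_complex_fact'

/-! ### The equator `S³ ↪ S⁴` and the Hopf circle action -/

/-- The isometric inclusion `ℝ⁴ = ℂ² ↪ ℂ² × ℝ = ℝ⁵`, `(x₁, y₁, x₂, y₂) ↦ (x₁, y₁, x₂, y₂, 0)`,
as a linear map. [folklore] -/
def padFiveₗ : 𝔼 4 →ₗ[ℝ] 𝔼 5 where
  toFun v := WithLp.toLp 2 ![v 0, v 1, v 2, v 3, 0]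
  map_add' v w := by
    ext i
    fin_cases i <;> simp
  map_smul' c v := by
    ext i
    fin_cases i <;> simp

/-- `(pad v)₀ = v₀`. [folklore] -/
@[simp] private theorem padFiveₗ_apply_zero (v : 𝔼 4) : padFiveₗ v 0 = v 0 := rfl
/-- `(pad v)₁ = v₁`. [folklore] -/
@[simp] private theorem padFiveₗ_apply_one (v : 𝔼 4) : padFiveₗ v 1 = v 1 := rfl
/-- `(pad v)₂ = v₂`. [folklore] -/
@[simp] private theorem padFiveₗ_apply_two (v : 𝔼 4) : padFiveₗ v 2 = v 2 := rfl
/-- `(pad v)₃ = v₃`. [folklore] -/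
@[simp] private theorem padFiveₗ_apply_three (v : 𝔼 4) : padFiveₗ v 3 = v 3 := rfl
/-- `(pad v)₄ = 0`. [folklore] -/
@[simp] private theorem padFiveₗ_apply_four (v : 𝔼 4) : padFiveₗ v 4 = 0 := rfl

/-- The real inner product on `ℝ⁴` in coordinates. [folklore] -/
private theorem euclid_inner_four (V W : 𝔼 4) :
    ⟪V, W⟫_ℝ = V 0 * W 0 + V 1 * W 1 + V 2 * W 2 + V 3 * W 3 := by
  simp [PiLp.inner_apply, Fin.sum_univ_four, mul_comm]

/-- `‖v‖² = Σ vᵢ²` on `ℝ⁴`. [folklore] -/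
private theorem euclid_norm_sq_four (v : 𝔼 4) : ‖v‖ ^ 2 = v 0 ^ 2 + v 1 ^ 2 + v 2 ^ 2 + v 3 ^ 2 := by
  rw [EuclideanSpace.real_norm_sq_eq, Fin.sum_univ_four]

/-- `‖v‖² = Σ vᵢ²` on `ℝ⁵`. [folklore] -/
private theorem euclid_norm_sq_five (v : 𝔼 5) :
    ‖v‖ ^ 2 = v 0 ^ 2 + v 1 ^ 2 + v 2 ^ 2 + v 3 ^ 2 + v 4 ^ 2 := by
  rw [EuclideanSpace.real_norm_sq_eq, Fin.sum_univ_five]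

/-- The inclusion `ℝ⁴ ↪ ℝ⁵` as a linear isometry. [folklore] -/
def padFive : 𝔼 4 →ₗᵢ[ℝ] 𝔼 5 :=
  { padFiveₗ with
    norm_map' := fun v => by
      have h : ‖padFiveₗ v‖ ^ 2 = ‖v‖ ^ 2 := by
        rw [euclid_norm_sq_five, euclid_norm_sq_four]
        simp
      exact (sq_eq_sq₀ (norm_nonneg _) (norm_nonneg _)).1 h }

/-- `(pad v)₀ = v₀`. [folklore] -/
@[simp] theorem padFive_apply_zero (v : 𝔼 4) : padFive v 0 = v 0 := rfl
/-- `(pad v)₁ = v₁`. [folklore] -/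
@[simp] theorem padFive_apply_one (v : 𝔼 4) : padFive v 1 = v 1 := rfl
/-- `(pad v)₂ = v₂`. [folklore] -/
@[simp] theorem padFive_apply_two (v : 𝔼 4) : padFive v 2 = v 2 := rfl
/-- `(pad v)₃ = v₃`. [folklore] -/
@[simp] theorem padFive_apply_three (v : 𝔼 4) : padFive v 3 = v 3 := rfl
/-- `(pad v)₄ = 0`. [folklore] -/
@[simp] theorem padFive_apply_four (v : 𝔼 4) : padFive v 4 = 0 := rfl

/-- `pad` maps `S³` into `S⁴`. [folklore] -/
theorem padFive_mem_sphere (n : 𝕊 3) : padFive (n : 𝔼 4) ∈ Metric.sphere (0 : 𝔼 5) 1 := by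
  rw [mem_sphere_zero_iff_norm, padFive.norm_map, norm_eq_of_mem_sphere n]

/-- **The equator** `S³ ↪ S⁴`, `n ↦ (n, 0)`: the folding hypersurface of Example 2.3.
[cite: CannasdasilvaGuilleminPires2010, Example 2.3] -/
def equatorIncl : (𝕊 3) → 𝕊 4 :=
  Set.codRestrict (fun n : 𝕊 3 => padFive (n : 𝔼 4)) _ padFive_mem_sphere

/-- The equator inclusion on underlying vectors is `pad`. [folklore] -/
theorem coe_equatorIncl (n : 𝕊 3) : (equatorIncl n : 𝔼 5) = padFive n := rfl

/-- The equator inclusion is an isometry. [folklore] -/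
theorem isometry_equatorIncl : Isometry equatorIncl :=
  Isometry.of_dist_eq fun a b => by
    rw [Subtype.dist_eq, Subtype.dist_eq, coe_equatorIncl, coe_equatorIncl, dist_eq_norm,
      dist_eq_norm, ← map_sub, LinearIsometry.norm_map]

/-- The equator inclusion is injective. [folklore] -/
theorem injective_equatorIncl : Injective equatorIncl :=
  isometry_equatorIncl.injective

/-- The image of the equator inclusion is `{h = 0}`. [folklore] -/
theorem range_equatorIncl : range equatorIncl = {x : 𝕊 4 | (x : 𝔼 5) 4 = 0} := by
  ext x
  constructor
  · rintro ⟨n, rfl⟩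
    rfl
  · intro hx
    have hx' : (x : 𝔼 5) 4 = 0 := hx
    have hn : (WithLp.toLp 2 ![(x : 𝔼 5) 0, (x : 𝔼 5) 1, (x : 𝔼 5) 2, (x : 𝔼 5) 3] : 𝔼 4) ∈
        Metric.sphere (0 : 𝔼 4) 1 := by
      have h1 : ‖(x : 𝔼 5)‖ ^ 2 = 1 := by rw [norm_eq_of_mem_sphere x, one_pow]
      rw [euclid_norm_sq_five, hx'] at h1
      rw [mem_sphere_zero_iff_norm]
      have h2 : ‖(WithLp.toLp 2 ![(x : 𝔼 5) 0, (x : 𝔼 5) 1, (x : 𝔼 5) 2, (x : 𝔼 5) 3] : 𝔼 4)‖ ^ 2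
          = 1 := by
        rw [euclid_norm_sq_four]
        simp
        linarith
      exact (pow_eq_one_iff_of_nonneg (norm_nonneg _) two_ne_zero).1 h2
    refine ⟨⟨_, hn⟩, ?_⟩
    ext i
    fin_cases i
    · rfl
    · rfl
    · rfl
    · rfl
    · exact hx'.symm

/-- The equator inclusion is `C^∞` (it is the restriction of a linear map).
[folklore] -/
theorem contMDiff_equatorIncl : ContMDiff (𝓡 3) (𝓡 4) ∞ equatorIncl := by
  have h : ContMDiff (𝓡 3) 𝓘(ℝ, 𝔼 5) ∞ (fun n : 𝕊 3 => padFive (n : 𝔼 4)) :=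
    padFive.toContinuousLinearMap.contDiff.contMDiff.comp (contMDiff_coe_sphere (E := 𝔼 4) (n := 3))
  exact h.codRestrict_sphere padFive_mem_sphere

/-- The complex structure `J(x₁, y₁, x₂, y₂) = (-y₁, x₁, -y₂, x₂)` of `ℂ² = ℝ⁴` (multiplication
by `i`), as a linear map. [folklore] -/
def rotFourₗ : 𝔼 4 →ₗ[ℝ] 𝔼 4 where
  toFun v := WithLp.toLp 2 ![-(v 1), v 0, -(v 3), v 2]
  map_add' v w := by
    ext i
    fin_cases i <;> simp <;> ring
  map_smul' c v := by
    ext i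
    fin_cases i <;> simp

/-- Multiplication by `i` on `ℂ² = ℝ⁴` as a continuous linear map. [folklore] -/
def rotFour : 𝔼 4 →L[ℝ] 𝔼 4 :=
  { rotFourₗ with cont := LinearMap.continuous_of_finiteDimensional _ }

/-- `(J v)₀ = -v₁`. [folklore] -/
@[simp] theorem rotFour_apply_zero (v : 𝔼 4) : rotFour v 0 = -(v 1) := rfl
/-- `(J v)₁ = v₀`. [folklore] -/
@[simp] theorem rotFour_apply_one (v : 𝔼 4) : rotFour v 1 = v 0 := rfl
/-- `(J v)₂ = -v₃`. [folklore] -/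
@[simp] theorem rotFour_apply_two (v : 𝔼 4) : rotFour v 2 = -(v 3) := rfl
/-- `(J v)₃ = v₂`. [folklore] -/
@[simp] theorem rotFour_apply_three (v : 𝔼 4) : rotFour v 3 = v 2 := rfl

/-- The Hopf action of `a ∈ S¹ ⊂ ℂ` on `ℝ⁴ = ℂ²` read through the inclusions:
`(a, v) ↦ (Re a) v + (Im a) J v`, i.e. `(z₁, z₂) ↦ (a z₁, a z₂)`. [folklore] -/
def hopfAux (p : Circle × (𝕊 3)) : 𝔼 4 :=
  (p.1 : ℂ).re • (p.2 : 𝔼 4) + (p.1 : ℂ).im • rotFour (p.2 : 𝔼 4)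

/-- Coordinates of the Hopf action: `(a · v)ᵢ = (Re a) vᵢ + (Im a) (J v)ᵢ`. [folklore] -/
private theorem hopfAux_apply (p : Circle × (𝕊 3)) (i : Fin 4) :
    hopfAux p i = (p.1 : ℂ).re * (p.2 : 𝔼 4) i + (p.1 : ℂ).im * rotFour (p.2 : 𝔼 4) i := by
  simp [hopfAux]

/-- The Hopf action preserves the unit sphere. [folklore] -/
theorem hopfAux_mem (p : Circle × (𝕊 3)) : hopfAux p ∈ Metric.sphere (0 : 𝔼 4) 1 := by
  have ha : (p.1 : ℂ).re ^ 2 + (p.1 : ℂ).im ^ 2 = 1 := by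
    have := Circle.normSq_coe p.1
    rw [Complex.normSq_apply] at this
    nlinarith
  have hn : ‖(p.2 : 𝔼 4)‖ ^ 2 = 1 := by rw [norm_eq_of_mem_sphere p.2, one_pow]
  rw [euclid_norm_sq_four] at hn
  rw [mem_sphere_zero_iff_norm]
  have h2 : ‖hopfAux p‖ ^ 2 = 1 := by
    rw [euclid_norm_sq_four, hopfAux_apply, hopfAux_apply, hopfAux_apply, hopfAux_apply]
    simp only [rotFour_apply_zero, rotFour_apply_one, rotFour_apply_two, rotFour_apply_three]
    nlinarith
  exact (pow_eq_one_iff_of_nonneg (norm_nonneg _) two_ne_zero).1 h2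

/-- **The Hopf circle action on the equator `S³`**: `a · (z₁, z₂) = (a z₁, a z₂)`; its orbits are
the fibres of the null fibration `S¹ ↪ S³ ↠ ℂℙ¹` of Example 2.3.
[cite: CannasdasilvaGuilleminPires2010, Example 2.3] -/
def hopfAction (a : Circle) (n : 𝕊 3) : 𝕊 3 :=
  Set.codRestrict hopfAux _ hopfAux_mem (a, n)

/-- The Hopf action on underlying vectors: `a · n = (Re a) n + (Im a) J n`. [folklore] -/
theorem coe_hopfAction (a : Circle) (n : 𝕊 3) :
    (hopfAction a n : 𝔼 4) = (a : ℂ).re • (n : 𝔼 4) + (a : ℂ).im • rotFour (n : 𝔼 4) := rfl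

/-- Coordinates of the Hopf action on `S³`. [folklore] -/
private theorem hopfAction_apply (a : Circle) (n : 𝕊 3) (i : Fin 4) :
    (hopfAction a n : 𝔼 4) i = (a : ℂ).re * (n : 𝔼 4) i + (a : ℂ).im * rotFour (n : 𝔼 4) i :=
  hopfAux_apply (a, n) i

/-- The Hopf action is `C^∞` jointly in `(a, n)`. [folklore] -/
theorem contMDiff_hopfAction :
    ContMDiff ((𝓡 1).prod (𝓡 3)) (𝓡 3) ∞ (fun p : Circle × (𝕊 3) => hopfAction p.1 p.2) := by
  have hΦ : ContDiff ℝ ∞ (fun q : ℂ × (𝔼 4) => q.1.re • q.2 + q.1.im • rotFour q.2) := by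
    apply ContDiff.add
    · exact (Complex.reCLM.contDiff.comp contDiff_fst).smul contDiff_snd
    · exact (Complex.imCLM.contDiff.comp contDiff_fst).smul (rotFour.contDiff.comp contDiff_snd)
  have h1 : ContMDiff ((𝓡 1).prod (𝓡 3)) 𝓘(ℝ, ℂ) ∞ (fun p : Circle × (𝕊 3) => (p.1 : ℂ)) :=
    (contMDiff_coe_sphere (E := ℂ) (n := 1)).comp contMDiff_fst
  have h2 : ContMDiff ((𝓡 1).prod (𝓡 3)) 𝓘(ℝ, 𝔼 4) ∞ (fun p : Circle × (𝕊 3) => (p.2 : 𝔼 4)) :=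
    (contMDiff_coe_sphere (E := 𝔼 4) (n := 3)).comp contMDiff_snd
  have h : ContMDiff ((𝓡 1).prod (𝓡 3)) 𝓘(ℝ, 𝔼 4) ∞ hopfAux :=
    hΦ.contMDiff.comp (h1.prodMk_space h2)
  exact h.codRestrict_sphere hopfAux_mem

/-- `1` acts trivially. [folklore] -/
theorem hopfAction_one (n : 𝕊 3) : hopfAction 1 n = n := by
  ext i
  rw [hopfAction_apply]
  simp

/-- The action law `(a b) · n = a · (b · n)` (uses `J² = -1`). [folklore] -/
theorem hopfAction_mul (a b : Circle) (n : 𝕊 3) :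
    hopfAction (a * b) n = hopfAction a (hopfAction b n) := by
  ext i
  rw [hopfAction_apply]
  fin_cases i <;>
    simp [hopfAction_apply, Circle.coe_mul, Complex.mul_re, Complex.mul_im] <;> ring

/-- The Hopf action is free. [folklore] -/
theorem hopfAction_eq_self (a : Circle) (n : 𝕊 3) (h : hopfAction a n = n) : a = 1 := by
  set c := (a : ℂ).re with hc
  set s := (a : ℂ).im with hs
  have ha : c ^ 2 + s ^ 2 = 1 := by
    have := Circle.normSq_coe a
    rw [Complex.normSq_apply] at this
    nlinarith
  have hn : ‖(n : 𝔼 4)‖ ^ 2 = 1 := by rw [norm_eq_of_mem_sphere n, one_pow]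
  rw [euclid_norm_sq_four] at hn
  have e0 := congrArg (fun m : 𝕊 3 => (m : 𝔼 4) 0) h
  have e1 := congrArg (fun m : 𝕊 3 => (m : 𝔼 4) 1) h
  have e2 := congrArg (fun m : 𝕊 3 => (m : 𝔼 4) 2) h
  have e3 := congrArg (fun m : 𝕊 3 => (m : 𝔼 4) 3) h
  simp only [hopfAction_apply, rotFour_apply_zero, rotFour_apply_one, rotFour_apply_two,
    rotFour_apply_three, ← hc, ← hs] at e0 e1 e2 e3
  have hc1 : c = 1 := by
    linear_combination (n : 𝔼 4) 0 * e0 + (n : 𝔼 4) 1 * e1 + (n : 𝔼 4) 2 * e2 +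
      (n : 𝔼 4) 3 * e3 - (c - 1) * hn
  have hs0 : s = 0 := by
    rw [hc1] at ha
    nlinarith
  apply Subtype.ext
  apply Complex.ext
  · simpa [← hc] using hc1
  · simpa [← hs] using hs0

/-! ### The pointwise conditions along the equator -/

/-- For a tangent vector `u` to `S³` at `n`, `d(ι ∘ j)(u) = pad (dι₃ u)`: the derivative of the
composite `S³ ↪ S⁴ ↪ ℝ⁵` factors through `ℝ⁴ ↪ ℝ⁵`. [folklore] -/
private theorem mfderiv_val_comp_equatorIncl (n : 𝕊 3) (u : TangentSpace (𝓡 3) n) :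
    (mfderiv (𝓡 4) 𝓘(ℝ, 𝔼 5) (Subtype.val : (𝕊 4) → 𝔼 5) (equatorIncl n)
        (mfderiv (𝓡 3) (𝓡 4) equatorIncl n u) : 𝔼 5) =
      padFive (mfderiv (𝓡 3) 𝓘(ℝ, 𝔼 4) (Subtype.val : (𝕊 3) → 𝔼 4) n u : 𝔼 4) := by
  have hj : MDifferentiableAt (𝓡 3) (𝓡 4) equatorIncl n :=
    contMDiff_equatorIncl.mdifferentiableAt (by simp)
  have hval : MDifferentiableAt (𝓡 4) 𝓘(ℝ, 𝔼 5) (Subtype.val : (𝕊 4) → 𝔼 5) (equatorIncl n) :=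
    (contMDiff_coe_sphere (E := 𝔼 5) (n := 4) (equatorIncl n)).mdifferentiableAt one_ne_zero
  have hval3 : MDifferentiableAt (𝓡 3) 𝓘(ℝ, 𝔼 4) (Subtype.val : (𝕊 3) → 𝔼 4) n :=
    (contMDiff_coe_sphere (E := 𝔼 4) (n := 3) n).mdifferentiableAt one_ne_zero
  have h1 := mfderiv_comp n hval hj
  have h2 : (Subtype.val : (𝕊 4) → 𝔼 5) ∘ equatorIncl =
      padFive.toContinuousLinearMap ∘ (Subtype.val : (𝕊 3) → 𝔼 4) := rfl
  have h3 := mfderiv_comp n (padFive.toContinuousLinearMap.hasMFDerivAt.mdifferentiableAt) hval3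
    (I' := 𝓘(ℝ, 𝔼 4)) (I'' := 𝓘(ℝ, 𝔼 5)) (g := padFive.toContinuousLinearMap)
  rw [← h2, h1, ContinuousLinearMap.mfderiv_eq] at h3
  exact congrArg (fun L => L u) h3

/-- The fifth basis vector `e₄ = ∂/∂h`. [folklore] -/
private def eFour : 𝔼 5 := WithLp.toLp 2 ![0, 0, 0, 0, 1]

/-- `(e₄)₀ = 0`. [folklore] -/
@[simp] private theorem eFour_apply_zero : eFour 0 = 0 := rfl
/-- `(e₄)₁ = 0`. [folklore] -/
@[simp] private theorem eFour_apply_one : eFour 1 = 0 := rfl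
/-- `(e₄)₂ = 0`. [folklore] -/
@[simp] private theorem eFour_apply_two : eFour 2 = 0 := rfl
/-- `(e₄)₃ = 0`. [folklore] -/
@[simp] private theorem eFour_apply_three : eFour 3 = 0 := rfl
/-- `(e₄)₄ = 1`. [folklore] -/
@[simp] private theorem eFour_apply_four : eFour 4 = 1 := rfl

/-- `e₄` is in the kernel of `ω₀` on all of `ℝ⁵`. [folklore] -/
private theorem presymplecticAltFive_eFour (W : 𝔼 5) : presymplecticAltFive ![eFour, W] = 0 := by
  rw [presymplecticAltFive_apply]
  simp

/-- `e₄` is tangent to `S⁴` along the equator. [folklore] -/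
private theorem inner_equatorIncl_eFour (n : 𝕊 3) : ⟪(equatorIncl n : 𝔼 5), eFour⟫_ℝ = 0 := by
  rw [euclid_inner_five]
  simp [coe_equatorIncl]

/-- **Maximal rank on the fold**: at a point of the equator the kernel of `ω₀|_{S⁴}` contains
the normal direction `∂/∂h`, which is not tangent to the equator.
[cite: CannasdasilvaGuilleminPires2010, Example 2.3] -/
theorem sphereOrigamiForm_maximalRank (n : 𝕊 3) :
    ∃ v : TangentSpace (𝓡 4) (equatorIncl n),
      (∀ w : TangentSpace (𝓡 4) (equatorIncl n), sphereOrigamiForm (equatorIncl n) ![v, w] = 0) ∧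
        v ∉ range (mfderiv (𝓡 3) (𝓡 4) equatorIncl n) := by
  obtain ⟨v, hv⟩ := exists_mfderiv_val_sphere_eq (equatorIncl n) (inner_equatorIncl_eFour n)
  refine ⟨v, fun w => ?_, ?_⟩
  · rw [sphereOrigamiForm_apply, hv]
    exact presymplecticAltFive_eFour _
  · rintro ⟨u, rfl⟩
    rw [mfderiv_val_comp_equatorIncl] at hv
    have := congrArg (fun z : 𝔼 5 => z 4) hv
    simp at this

/-- The curve `t ↦ ι (j (e^{it} · n))` in `ℝ⁵` is `cos t • ι j n + sin t • pad (J n)`.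
[folklore] -/
private theorem val_equatorIncl_hopfAction_exp (n : 𝕊 3) (t : ℝ) :
    ((equatorIncl (hopfAction (Circle.exp t) n) : 𝕊 4) : 𝔼 5) =
      Real.cos t • padFive (n : 𝔼 4) + Real.sin t • padFive (rotFour (n : 𝔼 4)) := by
  rw [coe_equatorIncl, coe_hopfAction, map_add, map_smul, map_smul, Circle.coe_exp,
    Complex.exp_ofReal_mul_I_re, Complex.exp_ofReal_mul_I_im]

/-- The velocity at `t = 0` of `t ↦ ι j (e^{it} · n)` is `pad (J n)`. [folklore] -/
private theorem hasDerivAt_val_equatorIncl_hopfAction (n : 𝕊 3) :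
    HasDerivAt (fun t : ℝ => ((equatorIncl (hopfAction (Circle.exp t) n) : 𝕊 4) : 𝔼 5))
      (padFive (rotFour (n : 𝔼 4))) 0 := by
  have h : HasDerivAt (fun t : ℝ => Real.cos t • padFive (n : 𝔼 4) +
      Real.sin t • padFive (rotFour (n : 𝔼 4)))
      ((-Real.sin 0) • padFive (n : 𝔼 4) + Real.cos 0 • padFive (rotFour (n : 𝔼 4))) 0 :=
    ((Real.hasDerivAt_cos 0).smul_const _).add ((Real.hasDerivAt_sin 0).smul_const _)
  rw [Real.sin_zero, Real.cos_zero, neg_zero, zero_smul, zero_add, one_smul] at h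
  refine h.congr_of_eventuallyEq (Filter.Eventually.of_forall fun t => ?_)
  exact val_equatorIncl_hopfAction_exp n t

/-- The orbit map `t ↦ j (e^{it} · n)` is `C^∞` into `S⁴`. [folklore] -/
private theorem contMDiff_equatorIncl_hopfAction_exp (n : 𝕊 3) :
    ContMDiff 𝓘(ℝ, ℝ) (𝓡 4) ∞ (fun t : ℝ => equatorIncl (hopfAction (Circle.exp t) n)) :=
  contMDiff_equatorIncl.comp
    (contMDiff_hopfAction.comp ((contMDiff_circleExp (m := ∞)).prodMk contMDiff_const))

/-- `A (pad (J n)) = - ι j n`: `ω₀(pad (J n), W) = -⟪j n, W⟫`. [folklore] -/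
private theorem rotFive_padFive_rotFour (n : 𝕊 3) :
    rotFive (padFive (rotFour (n : 𝔼 4))) = -((equatorIncl n : 𝕊 4) : 𝔼 5) := by
  ext i
  fin_cases i <;> simp [rotFive, coe_equatorIncl]

/-- **The Hopf orbits are tangent to the null foliation**: the velocity of the orbit
`t ↦ j (e^{it} · n)` lies in the kernel of `ω₀|_{S⁴}` at `j n` (printed:
"`ι_{∂/∂θ₁ + ∂/∂θ₂} ω₀ = -r₁ dr₁ - r₂ dr₂` is trivial on `Z`").
[cite: CannasdasilvaGuilleminPires2010, Example 2.3] -/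
theorem sphereOrigamiForm_orbit_tangent (n : 𝕊 3) (w : TangentSpace (𝓡 4) (equatorIncl n)) :
    sphereOrigamiForm (equatorIncl n)
      ![mfderiv 𝓘(ℝ, ℝ) (𝓡 4) (fun t : ℝ => equatorIncl (hopfAction (Circle.exp t) n)) 0 (1 : ℝ),
        w] = 0 := by
  set γ : ℝ → 𝕊 4 := fun t : ℝ => equatorIncl (hopfAction (Circle.exp t) n) with hγ
  have h0 : γ 0 = equatorIncl n := by
    simp only [hγ, Circle.exp_zero, hopfAction_one]
  have hγd : MDifferentiableAt 𝓘(ℝ, ℝ) (𝓡 4) γ 0 :=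
    (contMDiff_equatorIncl_hopfAction_exp n 0).mdifferentiableAt (by simp)
  have hval : MDifferentiableAt (𝓡 4) 𝓘(ℝ, 𝔼 5) (Subtype.val : (𝕊 4) → 𝔼 5) (γ 0) :=
    (contMDiff_coe_sphere (E := 𝔼 5) (n := 4) (γ 0)).mdifferentiableAt one_ne_zero
  -- the velocity in `ℝ⁵`
  have h1 := mfderiv_comp 0 hval hγd
  have h2 : mfderiv 𝓘(ℝ, ℝ) 𝓘(ℝ, 𝔼 5) ((Subtype.val : (𝕊 4) → 𝔼 5) ∘ γ) 0 (1 : ℝ) =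
      padFive (rotFour (n : 𝔼 4)) := by
    have hd := (hasDerivAt_val_equatorIncl_hopfAction n).hasFDerivAt
    rw [mfderiv_eq_fderiv, show ((Subtype.val : (𝕊 4) → 𝔼 5) ∘ γ) =
      (fun t : ℝ => ((equatorIncl (hopfAction (Circle.exp t) n) : 𝕊 4) : 𝔼 5)) from rfl, hd.fderiv]
    exact one_smul ℝ _
  rw [h1] at h2
  have h3 : (mfderiv (𝓡 4) 𝓘(ℝ, 𝔼 5) (Subtype.val : (𝕊 4) → 𝔼 5) (equatorIncl n)
      (mfderiv 𝓘(ℝ, ℝ) (𝓡 4) γ 0 (1 : ℝ)) : 𝔼 5) = padFive (rotFour (n : 𝔼 4)) := by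
    rw [← h0]
    exact h2
  rw [sphereOrigamiForm_apply]
  change presymplecticAltFive
    ![(mfderiv (𝓡 4) 𝓘(ℝ, 𝔼 5) (Subtype.val : (𝕊 4) → 𝔼 5) (equatorIncl n)
        (mfderiv 𝓘(ℝ, ℝ) (𝓡 4) γ 0 (1 : ℝ)) : 𝔼 5),
      (mfderiv (𝓡 4) 𝓘(ℝ, 𝔼 5) (Subtype.val : (𝕊 4) → 𝔼 5) (equatorIncl n) w : 𝔼 5)] = 0
  rw [h3, presymplecticAltFive_eq_inner_rotFive, rotFive_padFive_rotFour, inner_neg_left,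
    inner_mfderiv_val_sphere, neg_zero]

end Example23Equator

section Example23Smooth

open scoped InnerProductSpace
open Literature.NumberTheory.Transcendental

attribute [local instance] fact_finrank_five fact_finrank_four fact_finrank_five' fact_finrank_four'

/-! ### Chart representatives: smoothness and closedness -/

/-- The extended charts of `S⁴` (stereographic projections) have target all of `ℝ⁴`.
[folklore] -/
theorem extChartAt_sphere_target (x : 𝕊 4) : (extChartAt (𝓡 4) x).target = univ := by
  simp [chartAt, ChartedSpace.chartAt, stereographic'_target]

/-- The inverse extended chart `σ⁻¹ : ℝ⁴ → S⁴` is differentiable everywhere. [folklore] -/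
theorem mdifferentiable_extChartAt_sphere_symm (x : 𝕊 4) :
    MDifferentiable 𝓘(ℝ, 𝔼 4) (𝓡 4) (extChartAt (𝓡 4) x).symm := by
  intro y
  have hy : y ∈ (extChartAt (𝓡 4) x).target := by
    rw [extChartAt_sphere_target]; exact mem_univ y
  have h := mdifferentiableWithinAt_extChartAt_symm hy
  rwa [ModelWithCorners.Boundaryless.range_eq_univ, mdifferentiableWithinAt_univ] at h

/-- The parametrisation `g = ι ∘ σ⁻¹ : ℝ⁴ → ℝ⁵` of `S⁴` by the inverse chart at `x` is `C^∞`.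
[folklore] -/
theorem contDiff_val_extChartAt_sphere_symm (x : 𝕊 4) :
    ContDiff ℝ ∞ ((Subtype.val : (𝕊 4) → 𝔼 5) ∘ (extChartAt (𝓡 4) x).symm) := by
  have h1 := contMDiffOn_extChartAt_symm (I := 𝓡 4) (n := ∞) x
  rw [extChartAt_sphere_target] at h1
  have h2 := (contMDiff_coe_sphere (E := 𝔼 5) (n := 4) (m := ∞)).comp_contMDiffOn h1
  rw [contMDiffOn_iff_contDiffOn] at h2
  exact contDiffOn_univ.1 h2

/-- **The chart representative of `ω₀|_{S⁴}` is the pull-back of the constant form `ω₀` along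
`g = ι ∘ σ⁻¹`**: `(ω₀|_{S⁴})^_x (y) = ω₀ ∘ Dg(y)`. [folklore] -/
theorem sphereOrigamiForm_inChart (x : 𝕊 4) :
    sphereOrigamiForm.inChart x = fun y : 𝔼 4 =>
      (presymplecticAltFive.compContinuousLinearMap
        (fderiv ℝ ((Subtype.val : (𝕊 4) → 𝔼 5) ∘ (extChartAt (𝓡 4) x).symm) y) :
          (𝔼 4) [⋀^Fin 2]→L[ℝ] ℝ) := by
  have hval : MDifferentiable (𝓡 4) 𝓘(ℝ, 𝔼 5) (Subtype.val : (𝕊 4) → 𝔼 5) :=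
    (contMDiff_coe_sphere (E := 𝔼 5) (n := 4)).mdifferentiable one_ne_zero
  rw [inChart_eq_pullback, sphereOrigamiForm,
    ← MForm.pullback_comp hval (mdifferentiable_extChartAt_sphere_symm x)]
  funext y
  change (presymplecticAltFive.compContinuousLinearMap
    (mfderiv 𝓘(ℝ, 𝔼 4) 𝓘(ℝ, 𝔼 5) ((Subtype.val : (𝕊 4) → 𝔼 5) ∘ (extChartAt (𝓡 4) x).symm) y) :
      (𝔼 4) [⋀^Fin 2]→L[ℝ] ℝ) = _
  rw [mfderiv_eq_fderiv]

/-- The chart representative at a point: `ω₀ ∘ Dg(y)`. [folklore] -/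
theorem sphereOrigamiForm_inChart_apply (x : 𝕊 4) (y : 𝔼 4) :
    sphereOrigamiForm.inChart x y =
      presymplecticAltFive.compContinuousLinearMap
        (fderiv ℝ ((Subtype.val : (𝕊 4) → 𝔼 5) ∘ (extChartAt (𝓡 4) x).symm) y) := by
  rw [sphereOrigamiForm_inChart]

/-- **`ω₀|_{S⁴}` is a smooth form** (its chart representatives are pull-backs of a constant
form along `C^∞` maps). [cite: CannasdasilvaGuilleminPires2010, Example 2.3] -/
theorem isSmoothForm_sphereOrigamiForm : IsSmoothForm sphereOrigamiForm := by
  intro x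
  rw [sphereOrigamiForm_inChart x]
  apply ContDiffAt.contDiffWithinAt
  have hg := contDiff_val_extChartAt_sphere_symm x
  refine ContDiffAt.continuousAlternatingMapCompContinuousLinearMap ?_
    (hg.fderiv_right (by simp)).contDiffAt
  exact contDiffAt_const

/-- The exterior derivative of the constant form `ω₀` on `ℝ⁵` vanishes. [folklore] -/
theorem extDeriv_presymplecticMFormFive (p : 𝔼 5) :
    extDeriv (presymplecticMFormFive : (𝔼 5) → (𝔼 5) [⋀^Fin 2]→L[ℝ] ℝ) p = 0 := by
  unfold presymplecticMFormFive
  rw [extDeriv, fderiv_fun_const, Pi.zero_apply,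
    ← ContinuousAlternatingMap.alternatizeUncurryFinCLM_apply, map_zero]

/-- **`ω₀|_{S⁴}` is closed** (`d` commutes with pull-back, Mathlib's `extDeriv_pullback`, and
`dω₀ = 0` for the constant form `ω₀`). [cite: CannasdasilvaGuilleminPires2010, Example 2.3] -/
theorem isClosedForm_sphereOrigamiForm : IsClosedForm sphereOrigamiForm := by
  rw [IsClosedForm]
  funext x
  rw [mextDeriv_apply_eq_extDeriv, sphereOrigamiForm_inChart x]
  have hg := contDiff_val_extChartAt_sphere_symm x
  have key := extDeriv_pullback («ω» := (presymplecticMFormFive : (𝔼 5) → (𝔼 5) [⋀^Fin 2]→L[ℝ] ℝ))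
    (f := (Subtype.val : (𝕊 4) → 𝔼 5) ∘ (extChartAt (𝓡 4) x).symm) (x := extChartAt (𝓡 4) x x)
    (differentiableAt_const _) hg.contDiffAt
    (by rw [minSmoothness_of_isRCLikeNormedField]; exact WithTop.coe_le_coe.2 le_top)
  rw [extDeriv_presymplecticMFormFive] at key
  exact key.trans (by ext v; rfl)

end Example23Smooth

section Example23Immersion

open scoped InnerProductSpace

attribute [local instance] fact_finrank_five fact_finrank_four fact_finrank_five' fact_finrank_four'

/-! ### The equator is an embedded submanifold

In the stereographic charts at `n` (pole `-n`) and at `j n` (pole `-j n`), the inclusion `j` reads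
as the linear map `U₄ ∘ pad ∘ U₃⁻¹`, because `pad ∘ stereoInv_{-n} = stereoInv_{-j n} ∘ pad`. -/

/-- `pad` intertwines the inverse stereographic projections of `S³` and `S⁴`. [folklore] -/
private theorem padFive_stereoInvFunAux (v w : 𝔼 4) :
    padFive (stereoInvFunAux v w) = stereoInvFunAux (padFive v) (padFive w) := by
  simp only [stereoInvFunAux_apply, map_smul, map_add, padFive.norm_map]

/-- `ι (-j n) = pad (ι (-n))`. [folklore] -/
private theorem coe_neg_equatorIncl (n : 𝕊 3) :
    ((-equatorIncl n : 𝕊 4) : 𝔼 5) = padFive ((-n : 𝕊 3) : 𝔼 4) := by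
  rw [coe_neg_sphere, coe_neg_sphere, map_neg, coe_equatorIncl]

/-- The linear isometry `U₃ : (ℝ ∙ (-n))ᗮ ≃ ℝ³` entering the chart of `S³` at `n`. [folklore] -/
private def U₃ (n : 𝕊 3) : (ℝ ∙ ((-n : 𝕊 3) : 𝔼 4))ᗮ ≃ₗᵢ[ℝ] 𝔼 3 :=
  (OrthonormalBasis.fromOrthogonalSpanSingleton (𝕜 := ℝ) (E := 𝔼 4) 3
    (ne_zero_of_mem_unit_sphere (-n))).repr

/-- The linear isometry `U₄ : (ℝ ∙ (-j n))ᗮ ≃ ℝ⁴` entering the chart of `S⁴` at `j n`. [folklore] -/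
private def U₄ (n : 𝕊 3) : (ℝ ∙ ((-equatorIncl n : 𝕊 4) : 𝔼 5))ᗮ ≃ₗᵢ[ℝ] 𝔼 4 :=
  (OrthonormalBasis.fromOrthogonalSpanSingleton (𝕜 := ℝ) (E := 𝔼 5) 4
    (ne_zero_of_mem_unit_sphere (-equatorIncl n))).repr

/-- The chart of `S³` at `n` is `U₃ ∘ stereographic_{-n}`. [folklore] -/
private theorem chartAt_three (n : 𝕊 3) :
    chartAt (𝔼 3) n = stereographic (norm_eq_of_mem_sphere (-n)) ≫ₕ
      (U₃ n).toHomeomorph.toOpenPartialHomeomorph := rfl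

/-- The chart of `S⁴` at `j n` is `U₄ ∘ stereographic_{-j n}`. [folklore] -/
private theorem chartAt_four (n : 𝕊 3) :
    chartAt (𝔼 4) (equatorIncl n) = stereographic (norm_eq_of_mem_sphere (-equatorIncl n)) ≫ₕ
      (U₄ n).toHomeomorph.toOpenPartialHomeomorph := rfl

/-- `pad` maps `(-n)^⊥` into `(-j n)^⊥`. [folklore] -/
private theorem padFive_mem_orthogonal (n : 𝕊 3) (w : (ℝ ∙ ((-n : 𝕊 3) : 𝔼 4))ᗮ) :
    padFive (w : 𝔼 4) ∈ (ℝ ∙ ((-equatorIncl n : 𝕊 4) : 𝔼 5))ᗮ := by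
  rw [Submodule.mem_orthogonal_singleton_iff_inner_right, coe_neg_equatorIncl,
    LinearIsometry.inner_map_map]
  exact (Submodule.mem_orthogonal_singleton_iff_inner_right).1 w.2

/-- `pad` restricted to `(-n)^⊥ → (-j n)^⊥`. [folklore] -/
private def padOrth (n : 𝕊 3) :
    (ℝ ∙ ((-n : 𝕊 3) : 𝔼 4))ᗮ →ₗ[ℝ] (ℝ ∙ ((-equatorIncl n : 𝕊 4) : 𝔼 5))ᗮ :=
  (padFive.toLinearMap.comp (Submodule.subtype _)).codRestrict _ (padFive_mem_orthogonal n)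

/-- `padOrth` on underlying vectors is `pad`. [folklore] -/
@[simp] private theorem coe_padOrth (n : 𝕊 3) (w : (ℝ ∙ ((-n : 𝕊 3) : 𝔼 4))ᗮ) :
    (padOrth n w : 𝔼 5) = padFive (w : 𝔼 4) := rfl

/-- `e₄` lies in `(-j n)^⊥`. [folklore] -/
private theorem eFour_mem_orthogonal (n : 𝕊 3) :
    eFour ∈ (ℝ ∙ ((-equatorIncl n : 𝕊 4) : 𝔼 5))ᗮ := by
  rw [Submodule.mem_orthogonal_singleton_iff_inner_right, coe_neg_sphere, inner_neg_left,
    inner_equatorIncl_eFour, neg_zero]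

/-- In the charts at `n` and `j n`, the inclusion `j` extended by the normal coordinate:
`(y, t) ↦ U₄ (pad (U₃⁻¹ y) + t e₄)`. [folklore] -/
private def equatorChartMap (n : 𝕊 3) : (𝔼 3) × ℝ →ₗ[ℝ] 𝔼 4 :=
  ((U₄ n).toLinearEquiv.toLinearMap.comp
      ((padOrth n).comp (U₃ n).symm.toLinearEquiv.toLinearMap)).coprod
    ((U₄ n).toLinearEquiv.toLinearMap.comp
      (LinearMap.toSpanSingleton ℝ _ ⟨eFour, eFour_mem_orthogonal n⟩))

/-- Evaluation of the chart map: `(y, t) ↦ U₄ (pad (U₃⁻¹ y) + t e₄)`. [folklore] -/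
private theorem equatorChartMap_apply (n : 𝕊 3) (y : 𝔼 3) (t : ℝ) :
    equatorChartMap n (y, t) =
      U₄ n (padOrth n ((U₃ n).symm y) + t • ⟨eFour, eFour_mem_orthogonal n⟩) := by
  simp only [equatorChartMap, LinearMap.coprod_apply, LinearMap.comp_apply,
    LinearMap.toSpanSingleton_apply, ← map_add]
  rfl

/-- The chart map `(y, t) ↦ U₄ (pad (U₃⁻¹ y) + t e₄)` is injective. [folklore] -/
private theorem injective_equatorChartMap (n : 𝕊 3) : Injective (equatorChartMap n) := by
  rw [← LinearMap.ker_eq_bot, LinearMap.ker_eq_bot']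
  rintro ⟨y, t⟩ h
  rw [equatorChartMap_apply, LinearIsometryEquiv.map_eq_zero_iff] at h
  have hval : (padFive (((U₃ n).symm y : (ℝ ∙ ((-n : 𝕊 3) : 𝔼 4))ᗮ) : 𝔼 4) + t • eFour : 𝔼 5)
      = 0 := by
    have := congrArg Subtype.val h
    simpa only [Submodule.coe_add, Submodule.coe_smul, coe_padOrth, Submodule.coe_zero] using this
  have ht : t = 0 := by
    have := congrArg (fun z : 𝔼 5 => z 4) hval
    simpa using this
  rw [ht, zero_smul, add_zero] at hval
  have hw : (((U₃ n).symm y : (ℝ ∙ ((-n : 𝕊 3) : 𝔼 4))ᗮ) : 𝔼 4) = 0 := by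
    rw [← norm_eq_zero, ← padFive.norm_map, hval, norm_zero]
  have hy : y = 0 := by
    have h1 : (U₃ n).symm y = 0 := Subtype.ext hw
    have h2 := congrArg (U₃ n) h1
    rwa [LinearIsometryEquiv.apply_symm_apply, map_zero] at h2
  rw [hy, ht]
  rfl

/-- `dim (ℝ³ × ℝ) = dim ℝ⁴`. [folklore] -/
private theorem finrank_three_prod : Module.finrank ℝ ((𝔼 3) × ℝ) = Module.finrank ℝ (𝔼 4) := by
  rw [Module.finrank_prod, finrank_euclideanSpace_fin, finrank_euclideanSpace_fin,
    Module.finrank_self]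

/-- The linear change of coordinates `ℝ³ × ℝ ≃ ℝ⁴` exhibiting `j` as `u ↦ (u, 0)` in the charts at
`n` and `j n`. [folklore] -/
private def equatorChartEquiv (n : 𝕊 3) : ((𝔼 3) × ℝ) ≃L[ℝ] 𝔼 4 :=
  (LinearMap.linearEquivOfInjective (equatorChartMap n) (injective_equatorChartMap n)
    finrank_three_prod).toContinuousLinearEquiv

/-- The chart equivalence is the chart map. [folklore] -/
private theorem equatorChartEquiv_apply (n : 𝕊 3) (q : (𝔼 3) × ℝ) :
    equatorChartEquiv n q = equatorChartMap n q := by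
  simp [equatorChartEquiv]

/-- The value of the inverse chart of `S³` at `n`: `σ₃⁻¹ y = stereoInv_{-n} (U₃⁻¹ y)`. [folklore] -/
private theorem coe_chartAt_three_symm (n : 𝕊 3) (y : 𝔼 3) :
    (((chartAt (𝔼 3) n).symm y : 𝕊 3) : 𝔼 4) =
      stereoInvFunAux ((-n : 𝕊 3) : 𝔼 4) (((U₃ n).symm y : (ℝ ∙ ((-n : 𝕊 3) : 𝔼 4))ᗮ) : 𝔼 4) := by
  rw [chartAt_three]
  rfl

/-- `j ∘ σ₃⁻¹ = σ_{-jn}⁻¹ ∘ pad ∘ U₃⁻¹` pointwise. [folklore] -/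
private theorem equatorIncl_chartAt_three_symm (n : 𝕊 3) (y : 𝔼 3) :
    equatorIncl ((chartAt (𝔼 3) n).symm y) =
      (stereographic (norm_eq_of_mem_sphere (-equatorIncl n))).symm (padOrth n ((U₃ n).symm y)) := by
  apply Subtype.ext
  rw [coe_equatorIncl, coe_chartAt_three_symm, padFive_stereoInvFunAux, ← coe_neg_equatorIncl]
  rfl

/-- **In the charts at `n` and `j n` the equator inclusion is `u ↦ equiv (u, 0)`.** [folklore] -/
private theorem equatorIncl_writtenInExtend (n : 𝕊 3) :
    EqOn (((chartAt (𝔼 4) (equatorIncl n)).extend (𝓡 4)) ∘ equatorIncl ∘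
        ((chartAt (𝔼 3) n).extend (𝓡 3)).symm)
      (equatorChartEquiv n ∘ (·, (0 : ℝ))) ((chartAt (𝔼 3) n).extend (𝓡 3)).target := by
  intro y _
  simp only [Function.comp_apply, OpenPartialHomeomorph.extend_coe,
    OpenPartialHomeomorph.extend_coe_symm, modelWithCornersSelf_coe, modelWithCornersSelf_coe_symm,
    id_eq, equatorChartEquiv_apply, equatorChartMap_apply, zero_smul, add_zero]
  rw [equatorIncl_chartAt_three_symm, chartAt_four, OpenPartialHomeomorph.coe_trans,
    Function.comp_apply, (stereographic (norm_eq_of_mem_sphere (-equatorIncl n))).right_inv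
      (by rw [stereographic_target]; exact mem_univ _)]
  rfl

/-- **The equator inclusion `S³ ↪ S⁴` is a `C^∞` immersion** (with one-dimensional normal
complement). [folklore] -/
theorem isImmersion_equatorIncl : Manifold.IsImmersion (𝓡 3) (𝓡 4) ∞ equatorIncl := by
  refine ⟨ℝ, inferInstance, inferInstance, fun n => ?_⟩
  exact Manifold.IsImmersionAtOfComplement.mk_of_continuousAt
    (isometry_equatorIncl.continuous.continuousAt) (equatorChartEquiv n)
    (chartAt (𝔼 3) n) (chartAt (𝔼 4) (equatorIncl n)) (mem_chart_source _ n)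
    (mem_chart_source _ (equatorIncl n)) (IsManifold.chart_mem_maximalAtlas n)
    (IsManifold.chart_mem_maximalAtlas (equatorIncl n)) (equatorIncl_writtenInExtend n)

/-- **The equator inclusion `S³ ↪ S⁴` is a `C^∞` embedding.** [folklore] -/
theorem isSmoothEmbedding_equatorIncl :
    Manifold.IsSmoothEmbedding (𝓡 3) (𝓡 4) ∞ equatorIncl :=
  ⟨isImmersion_equatorIncl, isometry_equatorIncl.isEmbedding⟩

end Example23Immersion

section Example23Det

open scoped InnerProductSpace

attribute [local instance] fact_finrank_five fact_finrank_four fact_finrank_five' fact_finrank_four'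

/-! ### The chart Pfaffian as a volume: `Pf(ω₀ ∘ T) = vol₅(e₄, T e₀, …, T e₃)`

`ω₀ ∧ ω₀ = 2 dx₁ ∧ dy₁ ∧ dx₂ ∧ dy₂ = 2 ι_{∂/∂h} vol₅`, so the Pfaffian of the pulled-back form
`ω₀ ∘ T` on the standard basis of `ℝ⁴` is the `4 × 4` minor of `T` in the first four coordinates,
i.e. the volume of `(e₄, T e₀, …, T e₃)`. -/

/-- Laplace expansion of a `4 × 4` determinant along the first row. [folklore] -/
private theorem det_fin_four (A : Matrix (Fin 4) (Fin 4) ℝ) :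
    A.det =
      A 0 0 * (A 1 1 * A 2 2 * A 3 3 - A 1 1 * A 2 3 * A 3 2 - A 1 2 * A 2 1 * A 3 3
        + A 1 2 * A 2 3 * A 3 1 + A 1 3 * A 2 1 * A 3 2 - A 1 3 * A 2 2 * A 3 1)
      - A 0 1 * (A 1 0 * A 2 2 * A 3 3 - A 1 0 * A 2 3 * A 3 2 - A 1 2 * A 2 0 * A 3 3
        + A 1 2 * A 2 3 * A 3 0 + A 1 3 * A 2 0 * A 3 2 - A 1 3 * A 2 2 * A 3 0)
      + A 0 2 * (A 1 0 * A 2 1 * A 3 3 - A 1 0 * A 2 3 * A 3 1 - A 1 1 * A 2 0 * A 3 3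
        + A 1 1 * A 2 3 * A 3 0 + A 1 3 * A 2 0 * A 3 1 - A 1 3 * A 2 1 * A 3 0)
      - A 0 3 * (A 1 0 * A 2 1 * A 3 2 - A 1 0 * A 2 2 * A 3 1 - A 1 1 * A 2 0 * A 3 2
        + A 1 1 * A 2 2 * A 3 0 + A 1 2 * A 2 0 * A 3 1 - A 1 2 * A 2 1 * A 3 0) := by
  have s1 : Fin.succ (0 : Fin 3) = (1 : Fin 4) := by decide
  have s2 : Fin.succ (1 : Fin 3) = (2 : Fin 4) := by decide
  have s3 : Fin.succ (2 : Fin 3) = (3 : Fin 4) := by decide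
  have a00 : (0 : Fin 4).succAbove (0 : Fin 3) = 1 := by decide
  have a01 : (0 : Fin 4).succAbove (1 : Fin 3) = 2 := by decide
  have a02 : (0 : Fin 4).succAbove (2 : Fin 3) = 3 := by decide
  have a10 : (1 : Fin 4).succAbove (0 : Fin 3) = 0 := by decide
  have a11 : (1 : Fin 4).succAbove (1 : Fin 3) = 2 := by decide
  have a12 : (1 : Fin 4).succAbove (2 : Fin 3) = 3 := by decide
  have a20 : (2 : Fin 4).succAbove (0 : Fin 3) = 0 := by decide
  have a21 : (2 : Fin 4).succAbove (1 : Fin 3) = 1 := by decide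
  have a22 : (2 : Fin 4).succAbove (2 : Fin 3) = 3 := by decide
  have a30 : (3 : Fin 4).succAbove (0 : Fin 3) = 0 := by decide
  have a31 : (3 : Fin 4).succAbove (1 : Fin 3) = 1 := by decide
  have a32 : (3 : Fin 4).succAbove (2 : Fin 3) = 2 := by decide
  have v3 : ((3 : Fin 4) : ℕ) = 3 := rfl
  rw [Matrix.det_succ_row_zero, Fin.sum_univ_four]
  simp only [Matrix.det_fin_three, Matrix.submatrix_apply, s1, s2, s3, a00, a01, a02, a10, a11,
    a12, a20, a21, a22, a30, a31, a32, Fin.val_zero, Fin.val_one, Fin.val_two, v3, pow_zero,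
    pow_one]
  ring

/-- The standard volume form of `ℝ⁵` (determinant in the standard basis). [folklore] -/
private def volFive : (𝔼 5) [⋀^Fin 5]→ₗ[ℝ] ℝ := (EuclideanSpace.basisFun (Fin 5) ℝ).toBasis.det

/-- `vol₅(v) = det[(vⱼ)ᵢ]` (columns the vectors). [folklore] -/
private theorem volFive_apply (v : Fin 5 → 𝔼 5) :
    volFive v = Matrix.det (Matrix.of fun i j => v j i) := by
  rw [volFive, Module.Basis.det_apply]
  congr 1

/-- `f ∘ (a, b) = (f a, f b)` for pairs of vectors. [folklore] -/
private theorem comp_vecTwo (f : 𝔼 4 → 𝔼 5) (a b : 𝔼 4) : f ∘ ![a, b] = ![f a, f b] := by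
  funext i
  fin_cases i <;> rfl

/-- **`Pf(ω₀ ∘ T) = vol₅(e₄, T e₀, T e₁, T e₂, T e₃)`**: the Pfaffian of the pull-back of `ω₀` along
`T : ℝ⁴ → ℝ⁵`, on the standard basis, is the `4 × 4` minor of `T` in the coordinates
`x₁, y₁, x₂, y₂` (`ω₀ ∧ ω₀ = 2 ι_{∂/∂h} vol₅`). [folklore] -/
private theorem pfaffian_compContinuousLinearMap (T : (𝔼 4) →L[ℝ] 𝔼 5) :
    pfaffian (presymplecticAltFive.compContinuousLinearMap T) =
      volFive ![eFour, T (stdVec 0), T (stdVec 1), T (stdVec 2), T (stdVec 3)] := by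
  have c0 : (4 : Fin 5).succAbove (0 : Fin 4) = 0 := by decide
  have c1 : (4 : Fin 5).succAbove (1 : Fin 4) = 1 := by decide
  have c2 : (4 : Fin 5).succAbove (2 : Fin 4) = 2 := by decide
  have c3 : (4 : Fin 5).succAbove (3 : Fin 4) = 3 := by decide
  have s1 : Fin.succ (0 : Fin 4) = (1 : Fin 5) := by decide
  have s2 : Fin.succ (1 : Fin 4) = (2 : Fin 5) := by decide
  have s3 : Fin.succ (2 : Fin 4) = (3 : Fin 5) := by decide
  have s4 : Fin.succ (3 : Fin 4) = (4 : Fin 5) := by decide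
  have v4 : ((4 : Fin 5) : ℕ) = 4 := rfl
  rw [volFive_apply, Matrix.det_succ_column_zero, Fin.sum_univ_five]
  simp only [Matrix.of_apply, Matrix.cons_val_zero, eFour_apply_zero, eFour_apply_one,
    eFour_apply_two, eFour_apply_three, eFour_apply_four, mul_zero, zero_mul, zero_add, mul_one,
    det_fin_four, Matrix.submatrix_apply, c0, c1, c2, c3, s1, s2, s3, s4, v4]
  simp only [pfaffian, ContinuousAlternatingMap.compContinuousLinearMap_apply, comp_vecTwo,
    presymplecticAltFive_apply, Matrix.cons_val_one, Matrix.cons_val_zero, Matrix.cons_val]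
  ring

/-! ### Factorisation of the volume along the sphere: `vol₅(e₄, u) = p₄ · vol₅(p, u)` -/

/-- Five vectors orthogonal to a unit vector of `ℝ⁵` are linearly dependent (they lie in a
`4`-dimensional subspace). [folklore] -/
private theorem not_linearIndependent_of_inner_eq_zero (p : 𝔼 5) (hp : p ≠ 0) (v : Fin 5 → 𝔼 5)
    (hv : ∀ i, ⟪p, v i⟫_ℝ = 0) : ¬LinearIndependent ℝ v := by
  intro hli
  set K : Submodule ℝ (𝔼 5) := (ℝ ∙ p)ᗮ
  have hK : Module.finrank ℝ K = 4 := Submodule.finrank_orthogonal_span_singleton hp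
  have hmem : ∀ i, v i ∈ K := fun i =>
    (Submodule.mem_orthogonal_singleton_iff_inner_right).2 (hv i)
  have hli' : LinearIndependent ℝ (fun i => (⟨v i, hmem i⟩ : K)) :=
    LinearIndependent.of_comp K.subtype hli
  have h := hli'.fintype_card_le_finrank
  rw [Fintype.card_fin, hK] at h
  omega

/-- **`vol₅(e₄, u₀, …, u₃) = p₄ · vol₅(p, u₀, …, u₃)`** when `p` is a unit vector and the `uⱼ` are
orthogonal to `p`: decompose `e₄ = (e₄ - p₄ p) + p₄ p` with `e₄ - p₄ p ⟂ p`, and five vectors of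
`p^⊥` have zero volume. [folklore] -/
private theorem volFive_eFour_eq (p : 𝔼 5) (hp : ⟪p, p⟫_ℝ = 1) (u : Fin 4 → 𝔼 5)
    (hu : ∀ j, ⟪p, u j⟫_ℝ = 0) :
    volFive ![eFour, u 0, u 1, u 2, u 3] = p 4 * volFive ![p, u 0, u 1, u 2, u 3] := by
  have hp0 : p ≠ 0 := by
    intro h
    rw [h, inner_zero_left] at hp
    exact zero_ne_one hp
  set w : 𝔼 5 := eFour - p 4 • p with hw
  have hpw : ⟪p, w⟫_ℝ = 0 := by
    rw [hw, inner_sub_right, inner_smul_right, hp, mul_one, euclid_inner_five]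
    simp
  have hzero : volFive ![w, u 0, u 1, u 2, u 3] = 0 := by
    apply AlternatingMap.map_linearDependent
    apply not_linearIndependent_of_inner_eq_zero p hp0
    intro i
    fin_cases i
    · exact hpw
    · exact hu 0
    · exact hu 1
    · exact hu 2
    · exact hu 3
  have hdecomp : eFour = w + p 4 • p := by rw [hw, sub_add_cancel]
  calc volFive ![eFour, u 0, u 1, u 2, u 3]
      = volFive ![w + p 4 • p, u 0, u 1, u 2, u 3] := by rw [← hdecomp]
    _ = volFive ![w, u 0, u 1, u 2, u 3] + p 4 • volFive ![p, u 0, u 1, u 2, u 3] := by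
        rw [AlternatingMap.map_vecCons_add, AlternatingMap.map_vecCons_smul]
    _ = p 4 * volFive ![p, u 0, u 1, u 2, u 3] := by rw [hzero, zero_add, smul_eq_mul]

/-- **`vol₅(p, u₀, …, u₃) ≠ 0`** when `p` is a unit vector and `u₀, …, u₃` are linearly independent
and orthogonal to `p` (then `(p, u₀, …, u₃)` is a basis of `ℝ⁵`). [folklore] -/
private theorem volFive_ne_zero (p : 𝔼 5) (hp : ⟪p, p⟫_ℝ = 1) (u : Fin 4 → 𝔼 5)
    (hu : ∀ j, ⟪p, u j⟫_ℝ = 0) (hli : LinearIndependent ℝ u) :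
    volFive ![p, u 0, u 1, u 2, u 3] ≠ 0 := by
  have hcons : (![p, u 0, u 1, u 2, u 3] : Fin 5 → 𝔼 5) = Fin.cons p u := by
    funext i
    refine Fin.cases rfl (fun j => ?_) i
    fin_cases j <;> rfl
  have h5 : LinearIndependent ℝ (![p, u 0, u 1, u 2, u 3] : Fin 5 → 𝔼 5) := by
    rw [hcons, linearIndependent_finCons]
    refine ⟨hli, fun hmem => ?_⟩
    have hle : Submodule.span ℝ (Set.range u) ≤ (ℝ ∙ p)ᗮ := Submodule.span_le.2 (by
      rintro _ ⟨j, rfl⟩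
      exact (Submodule.mem_orthogonal_singleton_iff_inner_right).2 (hu j))
    have h1 := (Submodule.mem_orthogonal_singleton_iff_inner_right).1 (hle hmem)
    rw [hp] at h1
    exact one_ne_zero h1
  have hspan := h5.span_eq_top_of_card_eq_finrank' (by simp)
  have hunit := ((EuclideanSpace.basisFun (Fin 5) ℝ).toBasis.is_basis_iff_det).1 ⟨h5, hspan⟩
  exact hunit.ne_zero

end Example23Det

section Example23Transverse

open scoped InnerProductSpace

attribute [local instance] fact_finrank_five fact_finrank_four fact_finrank_five' fact_finrank_four'

/-! ### Transversality: `ω ∧ ω ⋔ 0` along the equator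

With `g = ι ∘ σ⁻¹` the parametrisation of `S⁴` by the inverse chart at `x₀`, the chart Pfaffian is
`P(y) = Pf(ω₀ ∘ Dg(y)) = vol₅(e₄, ∂₀g, …, ∂₃g)(y) = g₄(y) · vol₅(g, ∂₀g, …, ∂₃g)(y)` (the partial
derivatives are orthogonal to the unit vector `g(y)`), i.e. `ω ∧ ω = 2 h · dvol_{S⁴}` on `S⁴`.
At the centre `y₀` of the chart (`g(y₀) = x₀` on the equator, `g₄(y₀) = 0`),
`DP(y₀) = vol₅(x₀, dι e₀, …, dι e₃) · D(g₄)(y₀) ≠ 0`. -/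

/-- The parametrisation `g = ι ∘ σ_{x}⁻¹ : ℝ⁴ → ℝ⁵` of `S⁴` by the inverse extended chart at `x`.
[folklore] -/
private def chartParam (x : 𝕊 4) : 𝔼 4 → 𝔼 5 :=
  (Subtype.val : (𝕊 4) → 𝔼 5) ∘ (extChartAt (𝓡 4) x).symm

/-- The frame `∂ⱼ g (y) = Dg(y) eⱼ`, `j = 0, …, 3`. [folklore] -/
private def chartFrame (x : 𝕊 4) (y : 𝔼 4) (j : Fin 4) : 𝔼 5 :=
  fderiv ℝ (chartParam x) y (stdVec j)

/-- The Jacobian factor `G(y) = vol₅(g(y), ∂₀g(y), …, ∂₃g(y))`. [folklore] -/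
private def chartJac (x : 𝕊 4) (y : 𝔼 4) : ℝ :=
  volFive ![chartParam x y, chartFrame x y 0, chartFrame x y 1, chartFrame x y 2, chartFrame x y 3]

/-- `g = ι ∘ σ⁻¹` is `C^∞`. [folklore] -/
private theorem contDiff_chartParam (x : 𝕊 4) : ContDiff ℝ ∞ (chartParam x) :=
  contDiff_val_extChartAt_sphere_symm x

/-- `g` takes values in the unit sphere: `⟪g y, g y⟫ = 1`. [folklore] -/
private theorem inner_chartParam_self (x : 𝕊 4) (y : 𝔼 4) :
    ⟪chartParam x y, chartParam x y⟫_ℝ = 1 := by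
  rw [real_inner_self_eq_norm_sq, chartParam, Function.comp_apply, norm_eq_of_mem_sphere, one_pow]

/-- **Chain rule for `g = ι ∘ σ⁻¹`**: `Dg(y) v = dι (Dσ⁻¹(y) v)`. [folklore] -/
private theorem fderiv_chartParam_apply (x : 𝕊 4) (y : 𝔼 4) (v : 𝔼 4) :
    fderiv ℝ (chartParam x) y v =
      (mfderiv (𝓡 4) 𝓘(ℝ, 𝔼 5) (Subtype.val : (𝕊 4) → 𝔼 5) ((extChartAt (𝓡 4) x).symm y)
        (mfderiv 𝓘(ℝ, 𝔼 4) (𝓡 4) (extChartAt (𝓡 4) x).symm y v) : 𝔼 5) := by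
  have hval : MDifferentiableAt (𝓡 4) 𝓘(ℝ, 𝔼 5) (Subtype.val : (𝕊 4) → 𝔼 5)
      ((extChartAt (𝓡 4) x).symm y) :=
    (contMDiff_coe_sphere (E := 𝔼 5) (n := 4) _).mdifferentiableAt one_ne_zero
  have h := mfderiv_comp y hval (mdifferentiable_extChartAt_sphere_symm x y)
  rw [mfderiv_eq_fderiv] at h
  exact congrArg (fun L => L v) h

/-- The partial derivatives `∂ⱼ g` are tangent to the sphere: `⟪g y, Dg(y) v⟫ = 0`. [folklore] -/
private theorem inner_chartParam_fderiv (x : 𝕊 4) (y : 𝔼 4) (v : 𝔼 4) :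
    ⟪chartParam x y, fderiv ℝ (chartParam x) y v⟫_ℝ = 0 := by
  rw [fderiv_chartParam_apply]
  exact inner_mfderiv_val_sphere _ _

/-- Transport of `dι` along an equality of base points (avoids dependent rewriting). [folklore] -/
private theorem mfderiv_val_congr_point {p q : 𝕊 4} (h : p = q) (v : 𝔼 4) :
    (mfderiv (𝓡 4) 𝓘(ℝ, 𝔼 5) (Subtype.val : (𝕊 4) → 𝔼 5) p v : 𝔼 5) =
      (mfderiv (𝓡 4) 𝓘(ℝ, 𝔼 5) (Subtype.val : (𝕊 4) → 𝔼 5) q v : 𝔼 5) := by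
  subst h
  rfl

/-- **At the centre of the chart `Dg(y₀) = dι_{x}`** (the derivative of `σ⁻¹` at `σ x` is the
identity, Mathlib's `mfderivWithin_range_extChartAt_symm`). [folklore] -/
private theorem fderiv_chartParam_self (x : 𝕊 4) (v : 𝔼 4) :
    fderiv ℝ (chartParam x) (extChartAt (𝓡 4) x x) v =
      (mfderiv (𝓡 4) 𝓘(ℝ, 𝔼 5) (Subtype.val : (𝕊 4) → 𝔼 5) x v : 𝔼 5) := by
  rw [fderiv_chartParam_apply]
  have h1 := mfderivWithin_range_extChartAt_symm (I := 𝓡 4) (x := x)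
  rw [ModelWithCorners.Boundaryless.range_eq_univ, mfderivWithin_univ] at h1
  rw [h1]
  exact mfderiv_val_congr_point (extChartAt_to_inv x) v

/-- `g(σ x) = x`. [folklore] -/
private theorem chartParam_self (x : 𝕊 4) : chartParam x (extChartAt (𝓡 4) x x) = (x : 𝔼 5) :=
  congrArg Subtype.val (extChartAt_to_inv x)

/-- **The chart Pfaffian factorises: `Pf(ω̂_{x}(y)) = g₄(y) · G(y)`**. [folklore] -/
private theorem pfaffian_inChart_eq (x : 𝕊 4) (y : 𝔼 4) :
    pfaffian (sphereOrigamiForm.inChart x y) = chartParam x y 4 * chartJac x y := by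
  rw [sphereOrigamiForm_inChart_apply, pfaffian_compContinuousLinearMap]
  exact volFive_eFour_eq (chartParam x y) (inner_chartParam_self x y) (chartFrame x y)
    (fun j => inner_chartParam_fderiv x y (stdVec j))

/-- The determinant of a differentiable family of matrices is differentiable (Leibniz formula).
[folklore] -/
private theorem differentiableAt_det {A : 𝔼 4 → Matrix (Fin 5) (Fin 5) ℝ} {y : 𝔼 4}
    (hA : ∀ i j, DifferentiableAt ℝ (fun z => A z i j) y) :
    DifferentiableAt ℝ (fun z => (A z).det) y := by
  simp only [Matrix.det_apply, Units.smul_def, zsmul_eq_mul]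
  refine DifferentiableAt.fun_sum fun σ _ => ?_
  refine DifferentiableAt.const_mul ?_ _
  exact (HasFDerivAt.finsetProd (fun i _ => (hA (σ i) i).hasFDerivAt)).differentiableAt

/-- The frame vectors depend differentiably on the point. [folklore] -/
private theorem differentiableAt_chartFrame (x : 𝕊 4) (y : 𝔼 4) (j : Fin 4) :
    DifferentiableAt ℝ (fun z => chartFrame x z j) y := by
  have hD : DifferentiableAt ℝ (fderiv ℝ (chartParam x)) y :=
    (((contDiff_chartParam x).fderiv_right (m := ∞) (by simp)).differentiable (by simp)) y
  exact hD.clm_apply (differentiableAt_const _)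

/-- **The Jacobian factor `G` is differentiable.** [folklore] -/
private theorem differentiableAt_chartJac (x : 𝕊 4) (y : 𝔼 4) :
    DifferentiableAt ℝ (chartJac x) y := by
  have hg : DifferentiableAt ℝ (chartParam x) y :=
    ((contDiff_chartParam x).differentiable (by simp)) y
  have h : chartJac x = fun z => (Matrix.of fun i j =>
      (![chartParam x z, chartFrame x z 0, chartFrame x z 1, chartFrame x z 2, chartFrame x z 3] j)
        i).det := by
    funext z
    rw [chartJac, volFive_apply]
  rw [h]
  apply differentiableAt_det
  intro i j
  fin_cases j
  · simpa using (differentiableAt_euclidean.1 hg i)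
  · simpa using (differentiableAt_euclidean.1 (differentiableAt_chartFrame x y 0) i)
  · simpa using (differentiableAt_euclidean.1 (differentiableAt_chartFrame x y 1) i)
  · simpa using (differentiableAt_euclidean.1 (differentiableAt_chartFrame x y 2) i)
  · simpa using (differentiableAt_euclidean.1 (differentiableAt_chartFrame x y 3) i)

/-- The standard basis vectors `e₀, …, e₃` of `ℝ⁴` are linearly independent. [folklore] -/
private theorem linearIndependent_stdVec : LinearIndependent ℝ (stdVec : Fin 4 → 𝔼 4) := by
  have h : (stdVec : Fin 4 → 𝔼 4) = ⇑(EuclideanSpace.basisFun (Fin 4) ℝ).toBasis := by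
    funext i
    rw [OrthonormalBasis.coe_toBasis, EuclideanSpace.basisFun_apply]
    rfl
  rw [h]
  exact (EuclideanSpace.basisFun (Fin 4) ℝ).toBasis.linearIndependent

/-- **At the centre of the chart the frame `∂ⱼ g = dι eⱼ` is linearly independent.** [folklore] -/
private theorem linearIndependent_chartFrame_self (x : 𝕊 4) :
    LinearIndependent ℝ (chartFrame x (extChartAt (𝓡 4) x x)) := by
  set D : TangentSpace (𝓡 4) x →L[ℝ] 𝔼 5 :=
    mfderiv (𝓡 4) 𝓘(ℝ, 𝔼 5) (Subtype.val : (𝕊 4) → 𝔼 5) x with hD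
  have hinj : Injective D := mfderiv_coe_sphere_injective (E := 𝔼 5) (n := 4) x
  have hker : LinearMap.ker (D : TangentSpace (𝓡 4) x →ₗ[ℝ] 𝔼 5) = ⊥ :=
    LinearMap.ker_eq_bot.2 hinj
  have h := linearIndependent_stdVec.map' (D : TangentSpace (𝓡 4) x →ₗ[ℝ] 𝔼 5) hker
  have heq : chartFrame x (extChartAt (𝓡 4) x x) =
      ⇑(D : TangentSpace (𝓡 4) x →ₗ[ℝ] 𝔼 5) ∘ (stdVec : Fin 4 → 𝔼 4) := by
    funext j
    exact fderiv_chartParam_self x (stdVec j)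
  rw [heq]
  exact h

/-- **The Jacobian factor does not vanish at the centre of the chart.** [folklore] -/
private theorem chartJac_self_ne_zero (x : 𝕊 4) : chartJac x (extChartAt (𝓡 4) x x) ≠ 0 :=
  volFive_ne_zero _ (inner_chartParam_self x _) _
    (fun j => inner_chartParam_fderiv x _ (stdVec j)) (linearIndependent_chartFrame_self x)

/-- **The height `h ∘ g` has non-zero differential at the centre of a chart centred on the
equator** (`∂/∂h` is tangent to `S⁴` there). [folklore] -/
private theorem fderiv_chartParam_four_ne_zero (x : 𝕊 4) (hx : (x : 𝔼 5) 4 = 0) :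
    fderiv ℝ (fun y => chartParam x y 4) (extChartAt (𝓡 4) x x) ≠ 0 := by
  set y₀ := extChartAt (𝓡 4) x x with hy₀
  have hd : DifferentiableAt ℝ (chartParam x) y₀ :=
    ((contDiff_chartParam x).differentiable (by simp)) y₀
  have hcomp : HasFDerivAt (fun y => chartParam x y 4)
      ((EuclideanSpace.proj (4 : Fin 5)).comp (fderiv ℝ (chartParam x) y₀)) y₀ :=
    (EuclideanSpace.proj (𝕜 := ℝ) (4 : Fin 5)).hasFDerivAt.comp y₀ hd.hasFDerivAt
  rw [hcomp.fderiv]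
  obtain ⟨v, hv⟩ := exists_mfderiv_val_sphere_eq x (V := eFour) (by rw [euclid_inner_five]; simp [hx])
  intro h0
  have h1 := congrArg (fun L : (𝔼 4) →L[ℝ] ℝ => L v) h0
  simp only [ContinuousLinearMap.comp_apply] at h1
  rw [hy₀, fderiv_chartParam_self x v, hv] at h1
  simp at h1

/-- **Transversality of `ω ∧ ω` along the fold** (Def. 2.1 for Example 2.3): the chart Pfaffian
`P = (h ∘ g) · G` has differential `G(y₀) · D(h ∘ g)(y₀) ≠ 0` at the centre `y₀` of the chart at
a point of the equator. [cite: CannasdasilvaGuilleminPires2010, Example 2.3] -/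
theorem sphereOrigamiForm_transverse (x : 𝕊 4) (hx : x ∈ fold sphereOrigamiForm) :
    fderiv ℝ (fun y => pfaffian (sphereOrigamiForm.inChart x y)) (extChartAt (𝓡 4) x x) ≠ 0 := by
  rw [fold_sphereOrigamiForm] at hx
  have hx4 : (x : 𝔼 5) 4 = 0 := hx
  have hP : (fun y => pfaffian (sphereOrigamiForm.inChart x y)) =
      fun y => chartParam x y 4 * chartJac x y := funext (pfaffian_inChart_eq x)
  have hφ : DifferentiableAt ℝ (fun y => chartParam x y 4) (extChartAt (𝓡 4) x x) :=
    differentiableAt_euclidean.1 (((contDiff_chartParam x).differentiable (by simp)) _) 4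
  rw [hP, fderiv_fun_mul hφ (differentiableAt_chartJac x _), chartParam_self, hx4, zero_smul,
    zero_add]
  exact smul_ne_zero (chartJac_self_ne_zero x) (fderiv_chartParam_four_ne_zero x hx4)

end Example23Transverse

section Example23Assembly

attribute [local instance] fact_finrank_five fact_finrank_four fact_finrank_five' fact_finrank_four'

/-! ### Assembly -/

/-- **`ω₀|_{S⁴}` is a folded symplectic form with fold the equator** (Def. 2.1 for Example 2.3,
`n = 2`): smooth and closed, fold `= j(S³)`, `ω ∧ ω ⋔ 0` along it, maximal rank there.
[cite: CannasdasilvaGuilleminPires2010, Example 2.3] -/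
theorem isFoldedForm_sphereOrigamiForm : IsFoldedForm sphereOrigamiForm (𝕊 3) equatorIncl where
  smooth := isSmoothForm_sphereOrigamiForm
  closed := isClosedForm_sphereOrigamiForm
  embedding := isSmoothEmbedding_equatorIncl
  range_eq := by rw [range_equatorIncl, fold_sphereOrigamiForm]
  transverse := sphereOrigamiForm_transverse
  maximalRank := sphereOrigamiForm_maximalRank

/-- **`(S⁴, ω₀|)` is an origami manifold** (Cannas da Silva–Guillemin–Pires 2010, Example 2.3,
`n = 2`): the fold is the equator `S³` and the null foliation is the Hopf fibration, realised by
the free Hopf circle action. [cite: CannasdasilvaGuilleminPires2010, Example 2.3] -/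
theorem isOrigamiForm_sphereOrigamiForm : IsOrigamiForm sphereOrigamiForm :=
  ⟨⟨(𝕊 3), inferInstance, inferInstance, inferInstance, inferInstance, equatorIncl, hopfAction,
    isFoldedForm_sphereOrigamiForm, contMDiff_hopfAction, hopfAction_one, hopfAction_mul,
    hopfAction_eq_self, sphereOrigamiForm_orbit_tangent⟩⟩

/-- **Cannas da Silva–Guillemin–Pires 2010, Example 2.3 (`n = 2`), discharged**: the restriction
of `dx₁ ∧ dy₁ + dx₂ ∧ dy₂` to `S⁴ ⊂ ℂ² × ℝ` is an origami form and its fold is the equator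
`{h = 0}`. [cite: CannasdasilvaGuilleminPires2010, Example 2.3] -/
theorem CannasDaSilvaGuilleminPires2010_example_2_3_holds :
    CannasDaSilvaGuilleminPires2010_example_2_3 :=
  ⟨isOrigamiForm_sphereOrigamiForm, fold_sphereOrigamiForm⟩

end Example23Assembly

end Literature.Geometry.Symplectic

end
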